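import Literature.MathematicalPhysics.QuantumFieldTheory.Balaban1983to89.B9Thm311SitePrimeFormCoerciveTowerCanonical
import Literature.MathematicalPhysics.QuantumFieldTheory.Balaban1983to89.B9Eq324DeltaPrimeATower
import Literature.MathematicalPhysics.QuantumFieldTheory.Balaban1983to89.B9Eq368ProjectionRemainder

/-!
# `Balaban1983to89.B9Eq325GaugeModeLetterDiagonal` — T. Bałaban, *Propagators for lattice gauge theories in a background field*, Commun. Math. Phys. **99**
# (1985) 389–434 [Balaban1985BackgroundPropagators] (3.21)–(3.25) p. 394, (3.119)–(3.120) p. 419, Thm 3.11 p. 416, (3.35) p. 396: **THE GAUGE-MODE LETTER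
# OF THE `Δ_π` PORT ON PRINT's DIAGONAL — `λ_w := G′_kR_kD*_Uw` lies in `N(Q′_k(U))`, `Δ_Uλ_w = R_kD*_Uw`, and `‖λ_w‖, ‖D_Uλ_w‖ ≤ C·N₁(w)` with ONE
# `∃ α₀ C` BEFORE EVERY BINDER** — the row OWNER t4-ne9-p1 g87's OFFER O-ne9p1-g87-1 (the two displayed hypotheses `hλ`, `hDλ` of his θ-letter
# `B9Eq3120DeltaPiPrimeFormDiagonal`, step (ii) of `DELTA-PI-PROGRAMME.md`)

statement-level skeleton of published theorems with citation tags; proofs where landed; nothing here is a claim about the Yang–Mills mass gap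

PDF held: `paper:balaban1985-cmp99-background-propagators` (journal page = PDF page + 388), pp. 394, 396, 416, 419 — through the verbatim quotations of
`B9Eq324DeltaPrimeATower` ((3.24)–(3.25) at `n+1` levels), `B9Thm311SitePrimeFormCoerciveTowerCanonical` (Thm 3.11 for the site operator), `B11Eq103H1Complex`
((3.21) `R`), `B9Eq3119DeltaPiTower` ((3.119): `π = 1 − DG′RD*`).

CITATION HEADER (lean-in-tree rule).  Audit cell `pub-balaban`, sub-cell `t4`, BINDER row NE9; filed by the NE9 crux-team (2) LEAF PROVER 02 lineage
`b2b-balaban-t4-ne9-formalise-leaf-02` (gen 67) on the OWNER's OFFER O-ne9p1-g87-1 (journal `[NE9P1-G87-W6]`; TAKEN `[NE9LEAF02-G67]` W-6).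

WHY THIS FILE (cell context).  The θ-letter of the port (`|⟨u, (π_k†Δ^ηπ_k − Δ^η)v⟩| ≤ θ̄αN₁(u)N₁(v)`, the OWNER's INTENT-7) expands into three pairings
of the Hessian with the pure gauge modes `D_Uλ_u`, `D_Uλ_v`, `λ_w = G′_k(U)R_k(U)D*_Uw` (the site field inside `π_k(U)w = w − D_Uλ_w`); this
lineage's `B9Eq34CurlGaugeModeWindow` bounds each pairing by `α·(‖D_Uu‖‖λ‖ + ‖D_Uλ‖‖u‖)`-type products.  What remains are the LETTER BOUNDS of `λ_w`
in terms of the flat energy weight `N₁(w) = √(‖curl₁w‖² + ‖div₁w‖² + ‖w‖²)` — this file, `η`-free on the diagonal.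

WHAT IS PROVED (sorry-free; proof lane — no `def`, no `Prop` placeholder; [folklore] bookkeeping over landed theorems).
* **`exists_gaugeMode_letters_diagonal`** — `∃ α₀ C > 0` (closed in `(d, L, M_φ, M_φ′, a′, r)`: `α₀ = min α₁ 1`, `C = (γ′⁻¹ + 1)(1 + 2M_φM_φ′√d)` with
  `(α₁, γ′)` the site coercivity's) such that for every `n`, `η` (`ηL^{n+1} = 1`), `c₀, c₁` (`c₀(L^{n+1})^d = c₁`), `m`, background `U` with mutually
  adjoint transporters, `0 ≤ α ≤ α₀`, `U(b) ∈ U1`, `‖U(b) − 1‖ ≤ αη`, averaged windows `‖Ū^j(b) − 1‖ ≤ ε_j ≤ αr^j`, `Ū^j(b) ∈ U1`, ANY positivity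
  witness `hpos′` of `Δ′_{a′,k}(U)` and every bond field `w`, the site field `λ_w := GpOfUk … (RofUk … (covDivL2K ℂ c₀ η⁻¹ (adTransportW φ U⁻¹) w))`
  satisfies: (1) `QprimeTowerW … λ_w = 0`; (2) `covLaplaceSiteK η⁻¹ R(U) R(U⁻¹) λ_w = RofUk … (D*_Uw)`; (3) `‖λ_w‖ ≤ C·N₁(w)`; (4) `‖D_Uλ_w‖ ≤ C·N₁(w)`.
  MECHANISM: `R_kD*_Uw = Δ_Uλ₀` with `Q′_kλ₀ = 0` (`exists_ker_projR_eq` — `RofUk` IS `projR (Δ_U) (Q′_k)` by `rfl`) and `G′_k(Δ_Uλ₀) = λ₀`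
  (`GpOfUk_gaugeMode`), so `λ_w = λ₀`; the strong site coercivity `γ′(‖D_1λ‖² + ‖λ‖²) ≤ re⟨λ, Δ′_{a′,k}λ⟩`
  (`B9Thm311SitePrimeFormCoerciveTowerCanonical.exists_strong_site_coercive_tower_diagonal`, `∃` FIRST) with `Δ′_{a′,k}λ₀ = Δ_Uλ₀ = R_kD*_Uw` on `N(Q′_k)`
  (`laplacePrimeAk_apply_of_ker`) gives `γ′‖λ‖² ≤ ‖λ‖·‖R_kD*_Uw‖`; `‖D_Uλ‖² = re⟨λ, Δ′_{a′,k}λ⟩ ≤ γ′⁻¹‖R_kD*_Uw‖²` (`re_inner_laplacePrimeAk`);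
  `‖R_kD*_Uw‖ ≤ ‖D*_Uw‖` (`norm_projR_le`) and `‖D*_Uw‖ ≤ ‖D*_1w‖ + 2M_φM_φ′√d·α·‖w‖` (`norm_covDivL2K_sub_le` at the transporter window `2M_φM_φ′αη` —
  `B9Eq384RemainderLetters.norm_adTransportW_sub_le`; the `η⁻¹` of `D*` cancels the window's `η`), `α ≤ 1`, rows `≤ N₁`.
MODEL ∕ DECLARED READINGS.  (M1) those of `B9Eq324DeltaPrimeATower` ∕ `B9Thm311SitePrimeFormCoerciveTowerCanonical` (tower `towerP L m`, fibre `W` along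
`φ`, weights `c₀`, `c₁`, scalar `η⁻¹` on the diagonal, real `a′ > 0`, geometric profile ratio `r < 1`).  (M2) `hRS`, `U1`, the bond window, the averaged
windows and `hpos′` are HYPOTHESES (binders), as in the OWNER's INTENT-1∕-5∕-7; `C` depends on `a′` through `γ′`.
HONEST SCOPE.  [folklore] three-line coercivity arithmetic + composition BY NAME; no estimate at print's strength; NOT the θ-letter (the OWNER's assembly);
NOT summit progress (cell pub-balaban: NE9 NOT PRINTED ∕ NOT PROVED; «NE9 ⇐ the named binders»; row WALLED ON A MODEL (O-NE9-1; NEEDS-COORDINATOR #5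
UNRULED); spine PROVED 0∕9; rung (B)+1 finite T⁴ — NOT infinite volume, NOT mass gap, NOT BetaPertH, NOT Clay).  HONEST DEPENDENCY (cell line): continuum
YM on T⁴ ⇐ BetaPertH ∧ nine spine estimates (0/9 proved); BetaPertH ⇐ (D1) ∧ (D4) ∧ CAP+tail; G-an2-4 gates asym, D1 and NE2/3/4.  NEW file; nothing
modified.  Net new unproved facts: 0.
-/

noncomputable section

open scoped BigOperators InnerProductSpace ComplexConjugate

namespace Literature.MathematicalPhysics.QuantumFieldTheory.Balaban1983to89.B9Eq325GaugeModeLetterDiagonal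

open B4Sect5Torus (TSite)
open B9SectCLatticeCarrier (Bond)
open B7Prop1Explicit (U1)
open B9Eq311L2Pairing (WL2)
open B11Eq103H1Complex (SiteL2K BondL2K covDerivL2K covDivL2K covLaplaceSiteK projR exists_ker_projR_eq)
open B9Eq310HessianOperator (adTransportW covCurlL2K)
open B9Eq315QTower (towerP UlevOf)
open B9Eq326OperatorTower (QprimeTowerW RofUk)
open B5Eq172HodgePositivity (adTransportW_one adTransportW_inv_one)
open B9Eq324DeltaPrimeATower (laplacePrimeAk GpOfUk GpOfUk_gaugeMode laplacePrimeAk_apply_of_ker re_inner_laplacePrimeAk)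
open B9Thm311SitePrimeFormCoerciveTowerCanonical (exists_strong_site_coercive_tower_diagonal)
open B9Eq373DerivativeRemainderL2 (norm_covDivL2K_sub_le)
open B9Eq384RemainderLetters (norm_adTransportW_sub_le)
open B9Eq368ProjectionRemainder (norm_projR_le)

variable {d : ℕ} (L : ℕ) [NeZero L]
  {𝔸 : Type*} [NormedRing 𝔸] [NormedAlgebra ℂ 𝔸] [CompleteSpace 𝔸] [NormOneClass 𝔸]
  {W : Type*} [NormedAddCommGroup W] [InnerProductSpace ℂ W] [FiniteDimensional ℂ W] (φ : W ≃ₗ[ℂ] 𝔸)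
  {Mφ Mφ' : ℝ} (hMφ : 0 ≤ Mφ) (hMφ' : 0 ≤ Mφ') (hφ : ∀ w, ‖φ w‖ ≤ Mφ * ‖w‖) (hφ' : ∀ X, ‖φ.symm X‖ ≤ Mφ' * ‖X‖)
  {a' : ℝ} (ha' : 0 < a') {r : ℝ} (hr0 : 0 ≤ r) (hr1 : r < 1)

/-! ## §1 Arithmetic -/

omit [NeZero L] in
/-- `x ≤ √S` from `0 ≤ x` and `x² ≤ S`. [folklore] -/
private theorem le_sqrt_of_sq_le {x S : ℝ} (hx : 0 ≤ x) (h : x ^ 2 ≤ S) : x ≤ Real.sqrt S := by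
  calc x = Real.sqrt (x ^ 2) := (Real.sqrt_sq hx).symm
    _ ≤ Real.sqrt S := Real.sqrt_le_sqrt h

omit [NeZero L] in
/-- `γ·a² ≤ a·b`, `0 ≤ a`, `0 ≤ b`, `0 < γ` give `a ≤ γ⁻¹·b`. [folklore] -/
private theorem le_inv_mul_of_sq_le {γ a b : ℝ} (hγ : 0 < γ) (ha : 0 ≤ a) (hb : 0 ≤ b) (h : γ * a ^ 2 ≤ a * b) : a ≤ γ⁻¹ * b := by
  rcases ha.eq_or_lt with h0 | hpos
  · rw [← h0]; positivity
  · rw [le_inv_mul_iff₀ hγ]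
    nlinarith

omit [NeZero L] in
/-- `x² ≤ γ⁻¹·b²`, `0 ≤ x`, `0 ≤ b`, `0 < γ` give `x ≤ (γ⁻¹ + 1)·b` (`√(γ⁻¹) ≤ γ⁻¹ + 1`). [folklore] -/
private theorem le_of_sq_le_inv_mul_sq {γ x b : ℝ} (hγ : 0 < γ) (hx : 0 ≤ x) (hb : 0 ≤ b) (h : x ^ 2 ≤ γ⁻¹ * b ^ 2) :
    x ≤ (γ⁻¹ + 1) * b := by
  have hg : 0 ≤ γ⁻¹ := inv_nonneg.2 hγ.le
  have h1 : γ⁻¹ ≤ (γ⁻¹ + 1) ^ 2 := by nlinarith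
  have h2 : x ^ 2 ≤ ((γ⁻¹ + 1) * b) ^ 2 := by
    rw [mul_pow]; exact h.trans (mul_le_mul_of_nonneg_right h1 (sq_nonneg _))
  exact (pow_le_pow_iff_left₀ hx (by positivity) two_ne_zero).1 h2

/-! ## §2 The gauge-mode letter `λ_w = G′_kR_kD*_Uw` on the diagonal -/

include hMφ hMφ' hφ hφ' ha' hr0 hr1 in
/-- **THE GAUGE-MODE LETTER OF THE `Δ_π` PORT**: `∃ α₀ C > 0` (closed in `(d, L, M_φ, M_φ′, a′, r)`) before every lattice ∕ height ∕ volume ∕ background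
binder, such that on print's diagonal `ηL^{n+1} = 1`, for a background `U` with mutually adjoint transporters, `U(b) ∈ U1`, `‖U(b) − 1‖ ≤ αη`,
averaged windows `‖Ū^j(b) − 1‖ ≤ ε_j ≤ αr^j`, `Ū^j(b) ∈ U1`, `0 ≤ α ≤ α₀`, and ANY positivity witness `hpos′` of `Δ′_{a′,k}(U)`, the site field
`λ_w := G′_k(R_k(D*_Uw))` (`GpOfUk ∘ RofUk ∘ covDivL2K`) of every bond field `w` satisfies: `Q′_k(U)λ_w = 0`; `Δ_Uλ_w = R_kD*_Uw`; `‖λ_w‖ ≤ C·N₁(w)`;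
`‖D_Uλ_w‖ ≤ C·N₁(w)` — `N₁` the flat energy weight.  MECHANISM: `R_kD*_Uw = Δ_Uλ₀` with `Q′_kλ₀ = 0` (`exists_ker_projR_eq`), `G′_k(Δ_Uλ₀) = λ₀`
(`GpOfUk_gaugeMode`); `γ′(‖D_1λ‖² + ‖λ‖²) ≤ re⟨λ, Δ′_{a′,k}λ⟩ = re⟨λ, R_kD*_Uw⟩ ≤ ‖λ‖·‖R_kD*_Uw‖` (`exists_strong_site_coercive_tower_diagonal`,
`laplacePrimeAk_apply_of_ker`); `‖D_Uλ‖² = re⟨λ, Δ′λ⟩` on `N(Q′_k)` (`re_inner_laplacePrimeAk`); `‖R_kD*_Uw‖ ≤ ‖D*_Uw‖ ≤ ‖D*_1w‖ + 2√d·M_φM_φ′·α‖w‖`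
(`norm_projR_le`, `norm_covDivL2K_sub_le` with the transporter window `2M_φM_φ′αη` — the `η⁻¹` of `D*` cancels). [folklore]
[cite: Balaban1985BackgroundPropagators, (3.25) p.394, (3.119)–(3.120) p.419, Thm 3.11 p.416, (3.35) p.396] -/
theorem exists_gaugeMode_letters_diagonal :
    ∃ α₀ C : ℝ, 0 < α₀ ∧ 0 < C ∧ ∀ (n : ℕ) (η : ℝ), η * (L : ℝ) ^ (n + 1) = 1 →
      ∀ (c₀ c₁ : ℝ) [Fact (0 < c₀)] [Fact (0 < c₁)], c₀ * ((L : ℝ) ^ (n + 1)) ^ d = c₁ →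
      ∀ (m : Fin d → ℕ) [∀ i, NeZero (m i)] (U : Bond d (towerP L m (n + 1)) → 𝔸ˣ),
        (∀ (b : Bond d (towerP L m (n + 1))) (v u : W), ⟪adTransportW φ U b v, u⟫_ℂ = ⟪v, adTransportW φ (fun b => (U b)⁻¹) b u⟫_ℂ) →
      ∀ (α : ℝ), 0 ≤ α → α ≤ α₀ → (∀ b, U b ∈ U1 𝔸) → (∀ b, ‖(U b : 𝔸) - 1‖ ≤ α * η) →
      ∀ (εU : ℕ → ℝ), (∀ j, 0 ≤ εU j) → (∀ j < n + 1, εU j ≤ α * r ^ j) →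
        (∀ (j : ℕ) (b : Bond d (towerP L m (j + 1))), ‖(UlevOf L m (n + 1) U j b : 𝔸) - 1‖ ≤ εU j) →
        (∀ (j : ℕ) (b : Bond d (towerP L m (j + 1))), UlevOf L m (n + 1) U j b ∈ U1 𝔸) →
      ∀ (hpos' : ∀ x : SiteL2K ℂ d (towerP L m (n + 1)) c₀ W, x ≠ 0 →
          0 < RCLike.re ⟪x, laplacePrimeAk L m n φ η U a' (c₁ := c₁) x⟫_ℂ)
        (w : BondL2K ℂ d (towerP L m (n + 1)) c₀ W),
        QprimeTowerW L m n φ U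
            (GpOfUk L m n φ η U a' hpos' (RofUk L m n φ η U (covDivL2K ℂ c₀ ((η : ℂ))⁻¹ (adTransportW φ fun b => (U b)⁻¹) w))) = 0 ∧
        covLaplaceSiteK ((η : ℂ))⁻¹ (adTransportW φ U) (adTransportW φ fun b => (U b)⁻¹)
            (GpOfUk L m n φ η U a' hpos' (RofUk L m n φ η U (covDivL2K ℂ c₀ ((η : ℂ))⁻¹ (adTransportW φ fun b => (U b)⁻¹) w))) =
          RofUk L m n φ η U (covDivL2K ℂ c₀ ((η : ℂ))⁻¹ (adTransportW φ fun b => (U b)⁻¹) w) ∧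
        ‖GpOfUk L m n φ η U a' hpos' (RofUk L m n φ η U (covDivL2K ℂ c₀ ((η : ℂ))⁻¹ (adTransportW φ fun b => (U b)⁻¹) w))‖ ≤
          C * Real.sqrt (‖covCurlL2K ℂ c₀ ((η : ℂ))⁻¹ (adTransportW φ (fun _ : Bond d (towerP L m (n + 1)) => (1 : 𝔸ˣ))) w‖ ^ 2 +
            ‖covDivL2K ℂ c₀ ((η : ℂ))⁻¹ (adTransportW φ fun _ : Bond d (towerP L m (n + 1)) => (1 : 𝔸ˣ)⁻¹) w‖ ^ 2 + ‖w‖ ^ 2) ∧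
        ‖covDerivL2K ℂ c₀ ((η : ℂ))⁻¹ (adTransportW φ U)
            (GpOfUk L m n φ η U a' hpos' (RofUk L m n φ η U (covDivL2K ℂ c₀ ((η : ℂ))⁻¹ (adTransportW φ fun b => (U b)⁻¹) w)))‖ ≤
          C * Real.sqrt (‖covCurlL2K ℂ c₀ ((η : ℂ))⁻¹ (adTransportW φ (fun _ : Bond d (towerP L m (n + 1)) => (1 : 𝔸ˣ))) w‖ ^ 2 +
            ‖covDivL2K ℂ c₀ ((η : ℂ))⁻¹ (adTransportW φ fun _ : Bond d (towerP L m (n + 1)) => (1 : 𝔸ˣ)⁻¹) w‖ ^ 2 + ‖w‖ ^ 2) := by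
  obtain ⟨α₁, γ', hα₁, hγ', HC⟩ := exists_strong_site_coercive_tower_diagonal L φ hMφ hMφ' hφ hφ' ha' hr0 hr1
  obtain ⟨K, hKdef⟩ : ∃ K : ℝ, K = 1 + 2 * Mφ * Mφ' * Real.sqrt d := ⟨_, rfl⟩
  have hK1 : 1 ≤ K := by
    have h0 : 0 ≤ 2 * Mφ * Mφ' * Real.sqrt d := by positivity
    rw [hKdef]; linarith
  have hK0 : 0 < K := lt_of_lt_of_le one_pos hK1
  refine ⟨min α₁ 1, (γ'⁻¹ + 1) * K, lt_min hα₁ one_pos, by positivity, ?_⟩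
  intro n η hηL c₀ c₁ _ _ hw m _ U hRS α hα0 hαle hUb hUη εU hεU hεg hLε hLb hpos' w
  have hα₁' : α ≤ α₁ := hαle.trans (min_le_left _ _)
  have hαone : α ≤ 1 := hαle.trans (min_le_right _ _)
  have hLr : (0 : ℝ) < (L : ℝ) ^ (n + 1) := pow_pos (by exact_mod_cast Nat.pos_of_ne_zero (NeZero.ne L)) _
  have hη0 : 0 < η := pos_of_mul_pos_left (by rw [hηL]; exact one_pos) hLr.le
  have hc : conj (((η : ℂ))⁻¹) = ((η : ℂ))⁻¹ := by rw [map_inv₀, Complex.conj_ofReal]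
  -- the letters
  set Dstar := covDivL2K ℂ c₀ ((η : ℂ))⁻¹ (adTransportW φ fun b => (U b)⁻¹) w with hDstar
  set ρ := RofUk L m n φ η U Dstar with hρdef
  -- `ρ = Δ_U λ₀` with `Q′_k λ₀ = 0`, and `λ = λ₀`
  obtain ⟨l₀, hl₀Q, hl₀⟩ := exists_ker_projR_eq (covLaplaceSiteK ((η : ℂ))⁻¹ (adTransportW φ U) (adTransportW φ fun b => (U b)⁻¹))
    (QprimeTowerW L m n φ U (c₀ := c₀)) Dstar
  have hρ : ρ = covLaplaceSiteK ((η : ℂ))⁻¹ (adTransportW φ U) (adTransportW φ fun b => (U b)⁻¹) l₀ := hl₀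
  have hlam : GpOfUk L m n φ η U a' hpos' ρ = l₀ := by rw [hρ]; exact GpOfUk_gaugeMode L m n φ η U a' hpos' l₀ hl₀Q
  rw [hlam]
  -- the weight
  set N : ℝ := Real.sqrt (‖covCurlL2K ℂ c₀ ((η : ℂ))⁻¹ (adTransportW φ (fun _ : Bond d (towerP L m (n + 1)) => (1 : 𝔸ˣ))) w‖ ^ 2 +
      ‖covDivL2K ℂ c₀ ((η : ℂ))⁻¹ (adTransportW φ fun _ : Bond d (towerP L m (n + 1)) => (1 : 𝔸ˣ)⁻¹) w‖ ^ 2 + ‖w‖ ^ 2) with hN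
  have hN0 : 0 ≤ N := Real.sqrt_nonneg _
  have hNw : ‖w‖ ≤ N := by
    rw [hN]; exact le_sqrt_of_sq_le (norm_nonneg _) (le_add_of_nonneg_left (add_nonneg (sq_nonneg _) (sq_nonneg _)))
  have hNd : ‖covDivL2K ℂ c₀ ((η : ℂ))⁻¹ (adTransportW φ fun _ : Bond d (towerP L m (n + 1)) => (1 : 𝔸ˣ)⁻¹) w‖ ≤ N := by
    rw [hN]; exact le_sqrt_of_sq_le (norm_nonneg _) ((le_add_of_nonneg_left (sq_nonneg _)).trans (le_add_of_nonneg_right (sq_nonneg _)))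
  -- `‖D*_U w‖ ≤ ‖D*_1 w‖ + 2√d·M_φM_φ′·α·‖w‖ ≤ K·N`
  have hεR : 0 ≤ 2 * Mφ * Mφ' * (α * η) := by positivity
  have hR : ∀ (b : Bond d (towerP L m (n + 1))) (v : W), ‖adTransportW φ U b v - v‖ ≤ 2 * Mφ * Mφ' * (α * η) * ‖v‖ :=
    fun b v => norm_adTransportW_sub_le φ hφ hφ' hMφ' U b (hUb b) (hUη b) v
  have hR₁ : ∀ (b : Bond d (towerP L m (n + 1))) (v : W), adTransportW φ (fun _ : Bond d (towerP L m (n + 1)) => (1 : 𝔸ˣ)) b v = v :=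
    fun b v => by rw [adTransportW_one]; rfl
  have hS₁ : ∀ (b : Bond d (towerP L m (n + 1))) (v : W), adTransportW φ (fun _ : Bond d (towerP L m (n + 1)) => (1 : 𝔸ˣ)⁻¹) b v = v :=
    fun b v => by rw [adTransportW_inv_one]; rfl
  have hdiff := norm_covDivL2K_sub_le (𝕜 := ℂ) (c₀ := c₀) ((η : ℂ))⁻¹ hc hεR hR hR₁ hRS hS₁ w
  have hηn : ‖((η : ℂ))⁻¹‖ * (2 * Mφ * Mφ' * (α * η)) * Real.sqrt d = 2 * Mφ * Mφ' * Real.sqrt d * α := by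
    rw [norm_inv, Complex.norm_real, Real.norm_eq_abs, abs_of_pos hη0]; field_simp
  rw [hηn] at hdiff
  have hDs : ‖Dstar‖ ≤ K * N := by
    have h1 : ‖Dstar‖ ≤ ‖covDivL2K ℂ c₀ ((η : ℂ))⁻¹ (adTransportW φ fun _ : Bond d (towerP L m (n + 1)) => (1 : 𝔸ˣ)⁻¹) w‖ +
        2 * Mφ * Mφ' * Real.sqrt d * α * ‖w‖ :=
      calc ‖Dstar‖ = ‖covDivL2K ℂ c₀ ((η : ℂ))⁻¹ (adTransportW φ fun _ : Bond d (towerP L m (n + 1)) => (1 : 𝔸ˣ)⁻¹) w +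
            (Dstar - covDivL2K ℂ c₀ ((η : ℂ))⁻¹ (adTransportW φ fun _ : Bond d (towerP L m (n + 1)) => (1 : 𝔸ˣ)⁻¹) w)‖ := by
            rw [add_sub_cancel]
        _ ≤ _ := norm_add_le _ _
        _ ≤ _ := add_le_add_right hdiff _
    have h2 : 2 * Mφ * Mφ' * Real.sqrt d * α * ‖w‖ ≤ 2 * Mφ * Mφ' * Real.sqrt d * N := by
      have h3 : α * ‖w‖ ≤ 1 * N := mul_le_mul hαone hNw (norm_nonneg _) zero_le_one
      have h4 : 0 ≤ 2 * Mφ * Mφ' * Real.sqrt d := by positivity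
      nlinarith
    calc ‖Dstar‖ ≤ N + 2 * Mφ * Mφ' * Real.sqrt d * N := h1.trans (add_le_add hNd h2)
      _ = K * N := by rw [hKdef]; ring
  -- `‖ρ‖ ≤ ‖D*_U w‖`
  have hρN : ‖ρ‖ ≤ K * N := (norm_projR_le _ _ Dstar).trans hDs
  have hρ0 : 0 ≤ ‖ρ‖ := norm_nonneg _
  -- the coercivity at `λ₀`, read against `ρ`
  have hcoer := HC n η hηL c₀ c₁ hw m U hRS α hα0 hα₁' hUb hUη εU hεU hεg hLε hLb l₀
  have hform : RCLike.re ⟪l₀, laplacePrimeAk L m n φ η U a' (c₁ := c₁) l₀⟫_ℂ ≤ ‖l₀‖ * ‖ρ‖ := by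
    rw [laplacePrimeAk_apply_of_ker L m n φ η U a' (c₁ := c₁) hl₀Q, ← hρ]; exact re_inner_le_norm _ _
  have hl₀ : ‖l₀‖ ≤ γ'⁻¹ * ‖ρ‖ := by
    refine le_inv_mul_of_sq_le hγ' (norm_nonneg _) hρ0 ?_
    have h0 : 0 ≤ ‖covDerivL2K ℂ c₀ ((η : ℂ))⁻¹ (adTransportW φ (fun _ : Bond d (towerP L m (n + 1)) => (1 : 𝔸ˣ))) l₀‖ ^ 2 := sq_nonneg _
    nlinarith
  have hD : ‖covDerivL2K ℂ c₀ ((η : ℂ))⁻¹ (adTransportW φ U) l₀‖ ^ 2 ≤ γ'⁻¹ * ‖ρ‖ ^ 2 := by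
    have h1 : ‖covDerivL2K ℂ c₀ ((η : ℂ))⁻¹ (adTransportW φ U) l₀‖ ^ 2 = RCLike.re ⟪l₀, laplacePrimeAk L m n φ η U a' (c₁ := c₁) l₀⟫_ℂ := by
      rw [re_inner_laplacePrimeAk L m n φ η U a' hRS l₀, LinearMap.comp_apply, hl₀Q, map_zero, norm_zero]; ring
    rw [h1]
    calc RCLike.re ⟪l₀, laplacePrimeAk L m n φ η U a' (c₁ := c₁) l₀⟫_ℂ ≤ ‖l₀‖ * ‖ρ‖ := hform
      _ ≤ γ'⁻¹ * ‖ρ‖ * ‖ρ‖ := mul_le_mul_of_nonneg_right hl₀ hρ0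
      _ = γ'⁻¹ * ‖ρ‖ ^ 2 := by ring
  have hγ0 : 0 ≤ γ'⁻¹ := inv_nonneg.2 hγ'.le
  refine ⟨hl₀Q, hρ.symm, ?_, ?_⟩
  · calc ‖l₀‖ ≤ γ'⁻¹ * ‖ρ‖ := hl₀
      _ ≤ (γ'⁻¹ + 1) * (K * N) := mul_le_mul (by linarith) hρN hρ0 (by positivity)
      _ = (γ'⁻¹ + 1) * K * N := by ring
  · calc ‖covDerivL2K ℂ c₀ ((η : ℂ))⁻¹ (adTransportW φ U) l₀‖ ≤ (γ'⁻¹ + 1) * ‖ρ‖ := le_of_sq_le_inv_mul_sq hγ' (norm_nonneg _) hρ0 hD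
      _ ≤ (γ'⁻¹ + 1) * (K * N) := mul_le_mul_of_nonneg_left hρN (by positivity)
      _ = (γ'⁻¹ + 1) * K * N := by ring

end Literature.MathematicalPhysics.QuantumFieldTheory.Balaban1983to89.B9Eq325GaugeModeLetterDiagonal

end
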